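import Literature.NumberTheory.IwasawaTheory.PruferPontryaginDual
import Literature.NumberTheory.EllipticCurves.KellerYin2024.CharacterSelmerGroups
import Literature.NumberTheory.GaloisRepresentations.RestrictedRamification
import HarnessLib

/-!
# Keller–Yin's character module `(F/𝓞)(θ)` for `F = ℚ_p` IS the Prüfer module `ℚ_p/ℤ_p(θ)`:
# the rank-one CHARACTER INSTANCE of Greenberg's set-up — `ρ_θ` on `ℚ_p/ℤ_p`, its descent to
# `G_{K,S}`, and the `Γ_K`-equivariant identification `charModule ∅ θ ≃ QpModZp p` (kernel glue, 0 facts)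

Cell `bsd-eis` (FULL-BSD rank ≤ 1 programme, HOME `run/shared/lean/pub/bsd-eis/`), seat `bsd-eis-k5-ty`
gen 11 (typer), the GLUE items G-a / G-c / G-d of `HOME/k5-c2-MEMO-8.md` §(GLUE) for road (γ) of
crux 2 (`stmt-BirchSwinnertonDyer-19032`, line `halves` v5, `stub_noPseudoNull`), under planner RULING
L60 (plan of record: "GLUE G-a (Prüfer brick, k5-ty → then `charModule ∅ θ ≃ₗ QpModZp p` plumbing by
whoever consumes) / G-b σ-supply / G-c / G-d") and the L36 (2) proviso (idle typer takes kernel parts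
after saying so on HOME/STATUS.md — 2026-08-27 STARTED line of gen 11). WHY: the cell's INSTANCE
THEOREM `…Theorems.EisensteinPrimesTwistDeformationFullAtSelmer.twistDeformation_fullAtSelmer_isAlmostDivisible`
(Greenberg 2016 Prop. 4.1.1 (c) for the twist deformation `𝐃 = Ind_{K̃_∞/K}(A)`) is stated for an
ABSTRACT discrete `ℤ_p`-module `A` with a continuous `ℤ_p`-linear action `ρ₀` of `G_{K,S}` and the
"instance data" `hA`, `jQ/hinjQ/hsurjQ`, `jU/hinjU/hsurjU`, `hscalar`, `hcyc`; gen 10's brick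
`IwasawaTheory/PruferPontryaginDual.lean` supplies ALL the duality data from ONE
`e : A ≃ₗ[ℤ_[p]] QpModZp p`. The object the crux is ABOUT, however, is Keller–Yin's `(F/𝓞)(θ)` =
`KellerYin2024.charModule ∅ θ` for a character `θ : Γ_K → GL₁(𝓞)`, `𝓞 = 𝒪_{ℚ_p(∅)}` (the module of
`stub_noPseudoNull`'s `DualData₂ κ₁ κ₂ (charModule ∅ θ) vbar γ₁ γ₂`). This file closes that gap with
`A := QpModZp p`, `e := refl`:
* §1 `QpModZp.discreteTopology`, `QpModZp.continuousSMul` — Mathlib's quotient topology on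
  `ℚ_p ⧸ ℤ_p` is discrete and the `ℤ_p`-action is continuous (THEOREMS, not instances: this file
  declares no instance; a consumer binds them with `haveI`, exactly as the instance theorem binds its
  `[DiscreteTopology A]`); `QpModZp.exists_pow_zsmul_eq_zero` (the `p`-primarity clause of
  `Greenberg2006.thm3_twistDeformation_cohomology_addEquiv`, verbatim shape).
* §2 `ContinuousRep.scalar θ` — a continuous character `θ : G →ₜ* Aˣ` acting by scalars on a
  topological `A`-module is a `ContinuousRep` (Greenberg's rank-one `ρ₀`); §2b `QpModZp.characterRep p θ`
  = `ℚ_p/ℤ_p(θ)`, with `characterRep_hscalar` = the binder `hscalar` VERBATIM, functoriality under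
  restriction, and `characterRep_restrict_eq_trivial` (over a subgroup killed by `θ` the module is
  `ℚ_p/ℤ_p` with the trivial action — the coefficient module of the weak-Leopoldt fact p503293).
* §3 `padicIntEquivCoeffIntegersEmpty : ℤ_[p] ≃+* 𝒪_{ℚ_p(∅)}` (an isometry: `padicIntIsometryEquivCoeffIntegersEmpty`,
  both directions continuous) and `coeffFieldEmptyAlgEquiv : ℚ_p(∅) ≃ₐ[ℚ_p] ℚ_p`, with their
  characterisations inside `ℚ̄_p` and the compatibility along `𝓞 → F`.
* §4 `unitChar θ : Γ_K →ₜ* ℤ_pˣ` (= `det ∘ θ` read in `ℤ_p`; `padicIntEquiv_unitChar`: it is the entry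
  `θ(σ)₀₀`), `unitChar_pow_eq_one`, `isOpen_ker_unitChar_of_pow_eq_one` (a character of finite order —
  `stub_noPseudoNull`'s `∀ σ, θ σ ^ n = 1`, `0 < n` — has open kernel, so `RestrictedRamification`'s
  `ramificationSubgroup_le_ker` applies); **`charModuleEquiv θ : charModule ∅ θ ≃+ QpModZp p`**,
  `𝓞/ℤ_p`-semilinear (`charModuleEquiv_smul`, `charModuleEquiv_equiv_smul`) and **`Γ_K`-EQUIVARIANT**
  (`charModuleEquiv_galois_smul : e (σ • a) = unitChar θ σ • e a`).
* §5 `liftUnramifiedCont` (continuous factorisation `Γ_K →ₜ* H` ⟶ `G_{K,S} →ₜ* H` given `N_S ≤ ker`),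
  **`characterRepUnramified S θ h : ContinuousRep (G_{K,S}) ℤ_[p] (QpModZp p)`** = the `ρ₀` of the
  instance theorem for KY's `θ` (given `h : N_S ≤ ker (unitChar θ)`, i.e. `θ` unramified outside `S`),
  `characterRepUnramified_hscalar` (binder `hscalar` verbatim), `charModuleEquiv_galois_smul_unramified`
  (equivariance along `Γ_K ↠ G_{K,S}`), `characterRepUnramified_restrict_eq_trivial`.
CONSUMPTION (road (γ), for the k5-c2-class prover who writes the Theorems corollary of the instance
theorem at `A_θ`): `A := QpModZp p`, `ρ₀ := characterRepUnramified S θ h`,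
`[DiscreteTopology A] := QpModZp.discreteTopology p`, `hA := charModule_hA` (= the brick's
`QpModZp.exists_pow_nsmul_eq_zero`), `hscalar := characterRepUnramified_hscalar S θ h`,
`jQ/hinjQ/hsurjQ := QpModZp.exists_character_hinj_hsurj`, `jU/hinjU/hsurjU :=
QpModZp.exists_unitsCarrier_hinj_hsurj_of_linearEquiv K (LinearEquiv.refl _ _)`, `hcyc :=
QpModZp.exists_units_apply_eq_smul` (brick §5), `hsup :=` k5-c2's
`exists_resGal_apply_ne_one_of_isTopGeneratorPair`; and the K-Sh bridge reads `(F/𝓞)(θ)` through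
`charModuleEquiv` / `charModuleEquiv_galois_smul_unramified`. Interface checked in a seat scratch file
(`twistDeformation S hS κ₁ κ₂ (characterRepUnramified S θ h)` elaborates; the `hA`, `hscalar` and
Thm-3 `p`-primarity binders are these theorems by `exact`).
NOT HERE (honest scope): the proof that a given KY character is unramified outside a given `S`
(the consumer's `h`, via `ramificationSubgroup_le_ker`); the σ-supply (k5-c2 p520977); the K-Sh
descent and LEO (HOME/STATUS.md 2026-08-27 k5-ty g11 FINDING); any statement about `twistDeformation`
(this file does not import `Greenberg2006`). Kernel plumbing only: NO named fact, no instance, no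
notation, no `sorry`.

## References
* [KellerYin2024] T. Keller, M. Yin, arXiv:2402.12781v2, §1.1 (TeX L441–449: `θ : G_K → 𝓞^×`,
  `(F/𝓞)(θ)`, `M_θ = 𝓞(θ) ⊗ Λ^∨`).
* [Greenberg2006] R. Greenberg, *On the structure of certain Galois cohomology groups*, Doc. Math.
  Extra Vol. Coates (2006) 335–391 — p. 341 L6–10 (discrete `D ≅ (ℚ_p/ℤ_p)ⁿ`), p. 342 L2–5 (rank-one
  `ρ₀`, `κ`), pp. 343–344 (`D = ℚ_p/ℤ_p` with trivial action).
* [NeukirchSchmidtWingberg2008] VIII §3 (`G_S = Gal(k_S/k)` as a quotient of `G_k`).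
* [SerreGaloisCohomology1997] Ch. I §1.1 (profinite groups, open subgroups; discrete modules §2.1).
* Cell records: HOME/k5-c2-MEMO-8.md §(GLUE); HOME/STATUS.md RULINGS L59 (1), L60; gen-10 brick
  `Literature/NumberTheory/IwasawaTheory/PruferPontryaginDual.lean` (p518442, p521553).
-/

noncomputable section

open scoped Classical
open NumberField IsDedekindDomain Field
open Literature.NumberTheory.GaloisRepresentations

universe u

/-! ## §1. The Prüfer module `ℚ_p/ℤ_p` is discrete and its `ℤ_p`-action is continuous -/

namespace Literature.NumberTheory.IwasawaTheory.QpModZp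

variable (p : ℕ) [Fact p.Prime]

/-- `ℤ_p ⊂ ℚ_p` (the submodule `ℤ_p · 1`) is the closed unit ball, hence OPEN (ultrametric).
[cite: SerreGaloisCohomology1997, Ch. I §1.1 (profinite/discrete conventions)] -/
theorem isOpen_one : IsOpen ((1 : Submodule ℤ_[p] ℚ_[p]) : Set ℚ_[p]) := by
  have h : ((1 : Submodule ℤ_[p] ℚ_[p]) : Set ℚ_[p]) = Metric.closedBall (0 : ℚ_[p]) 1 := by
    ext q
    rw [SetLike.mem_coe, mem_one_iff, Metric.mem_closedBall, dist_zero_right]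
  rw [h]
  exact IsUltrametricDist.isOpen_closedBall (0 : ℚ_[p]) one_ne_zero

/-- **`ℚ_p/ℤ_p` is DISCRETE** for Mathlib's quotient topology (quotient of `ℚ_p` by the open subgroup
`ℤ_p`): the "discrete `G`-module" convention of the cell's instance theorem (`[DiscreteTopology A]`).
Stated as a theorem (no instance is declared in this file); consumers bind it with `haveI`.
[cite: Greenberg2006, p. 341 L6–10 ("a discrete `Gal(K_Σ/K)`-module `D` isomorphic to `(ℚ_p/ℤ_p)ⁿ`")] -/
theorem discreteTopology : DiscreteTopology (QpModZp p) :=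
  QuotientAddGroup.discreteTopology (N := (1 : Submodule ℤ_[p] ℚ_[p]).toAddSubgroup) (isOpen_one p)

/-- **The `ℤ_p`-action on `ℚ_p/ℤ_p` is (jointly) continuous**: each `x` is killed by some `p^k`, and
`c ↦ c • x` only depends on `c mod p^k` (`smul_eq_of_sub_mem_of_nsmul_eq_zero`), so it is locally
constant. Stated as a theorem (no instance declared); consumers bind it with `haveI`.
[cite: Greenberg2006, p. 341 L6–10] -/
theorem continuousSMul : ContinuousSMul ℤ_[p] (QpModZp p) := by
  haveI := discreteTopology p
  refine ⟨continuous_prod_of_discrete_right.mpr fun x ↦ ?_⟩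
  obtain ⟨k, hk⟩ := exists_pow_nsmul_eq_zero (p := p) x
  refine (IsLocallyConstant.iff_eventually_eq _).mpr (fun c₀ ↦ ?_) |>.continuous
  have hU : IsOpen {c : ℤ_[p] | c - c₀ ∈ Ideal.span {(p : ℤ_[p]) ^ k}} := by
    have : {c : ℤ_[p] | c - c₀ ∈ Ideal.span {(p : ℤ_[p]) ^ k}} =
        (fun c : ℤ_[p] ↦ c - c₀) ⁻¹' Metric.closedBall (0 : ℤ_[p]) ((p : ℝ) ^ (-(k : ℤ))) := by
      ext c
      simp only [Set.mem_setOf_eq, Set.mem_preimage, Metric.mem_closedBall, dist_zero_right,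
        PadicInt.norm_le_pow_iff_mem_span_pow]
    rw [this]
    refine (IsUltrametricDist.isOpen_closedBall (0 : ℤ_[p]) ?_).preimage (by fun_prop)
    exact (zpow_pos (by exact_mod_cast (Fact.out : p.Prime).pos) _).ne'
  filter_upwards [hU.mem_nhds (by simp)] with c hc
  exact smul_eq_of_sub_mem_of_nsmul_eq_zero hk hc

/-- `ℚ_p/ℤ_p` is `p`-primary, in the `ℤ`-scalar currency of `Greenberg2006.thm3_…` /
`IndModule₂.exists_pow_smul_eq_zero` (`(p ^ n : ℤ) • a = 0`). [cite: Greenberg2006, p. 341 L6–10] -/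
theorem exists_pow_zsmul_eq_zero (x : QpModZp p) : ∃ n : ℕ, (p ^ n : ℤ) • x = 0 := by
  obtain ⟨k, hk⟩ := exists_pow_nsmul_eq_zero (p := p) x
  exact ⟨k, by exact_mod_cast hk⟩

end Literature.NumberTheory.IwasawaTheory.QpModZp

/-! ## §2. Continuous characters act continuously by scalars on discrete torsion modules -/

namespace Literature.NumberTheory.GaloisRepresentations.ContinuousRep

variable {G : Type*} [Group G] [TopologicalSpace G]
  {A : Type*} [CommRing A] [TopologicalSpace A]
  {M : Type*} [AddCommGroup M] [Module A M] [TopologicalSpace M]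

/-- **The scalar representation of a continuous character** `θ : G →ₜ* Aˣ` on a topological
`A`-module `M` with continuous `A`-action: `g ↦ (θ g) • ·` (Greenberg's rank-one `ρ₀` on
`D = A_θ`; KY's `(F/𝓞)(θ)`). [cite: Greenberg2006, p. 342 L2–5 (a representation of rank 1)]
[cite: KellerYin2024, §1.1 (arXiv:2402.12781v2 TeX L441–449)] -/
def scalar [ContinuousSMul A M] (θ : G →ₜ* Aˣ) : ContinuousRep G A M where
  toRepresentation :=
    { toFun := fun g ↦ LinearMap.lsmul A M ((θ g : Aˣ) : A)
      map_one' := by ext m; simp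
      map_mul' := fun g h ↦ by
        ext m
        simp only [map_mul, Units.val_mul, LinearMap.lsmul_apply, Module.End.mul_apply, mul_smul] }
  continuous_smul := by
    show Continuous fun q : G × M ↦ (((θ q.1 : Aˣ) : A)) • q.2
    exact (Units.continuous_val.comp ((map_continuous θ).comp continuous_fst)).smul continuous_snd

/-- Unfolding: `scalar θ g m = θ(g) • m`. [cite: Greenberg2006, p. 342 L2–5] -/
@[simp] theorem scalar_apply [ContinuousSMul A M] (θ : G →ₜ* Aˣ) (g : G) (m : M) :
    scalar (M := M) θ g m = ((θ g : Aˣ) : A) • m :=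
  rfl

/-- `hscalar` of the cell's instance theorem (`…TwistDeformationFullAtSelmer`, binder `hscalar`):
every `g` acts on `M` through a UNIT scalar. [cite: Greenberg2006, p. 342 L2–5] -/
theorem exists_units_forall_scalar_apply [ContinuousSMul A M] (θ : G →ₜ* Aˣ) (g : G) :
    ∃ t : Aˣ, ∀ m : M, scalar (M := M) θ g m = (t : A) • m :=
  ⟨θ g, fun _ ↦ rfl⟩

/-- Restricting a scalar representation along `φ : H →ₜ* G` is the scalar representation of
`θ ∘ φ`. [cite: Greenberg2006, p. 342 L2–5 (the rank-one representation `ρ₀`, restriction to subgroups)] -/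
theorem scalar_restrict [ContinuousSMul A M] (θ : G →ₜ* Aˣ) {H : Type*} [Group H]
    [TopologicalSpace H] (φ : H →ₜ* G) :
    (scalar (M := M) θ).restrict φ = scalar (M := M) (θ.comp φ) :=
  rfl

/-- On a subgroup where the character is trivial, the scalar representation restricts to the
TRIVIAL representation (the situation over `K_θ`: `A_θ` becomes `ℚ_p/ℤ_p` with trivial action).
[cite: Greenberg2006, pp. 343–344 (the case `D = ℚ_p/ℤ_p` with trivial action)] -/
theorem scalar_restrict_eq_trivial [ContinuousSMul A M] (θ : G →ₜ* Aˣ) {H : Type*} [Group H]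
    [TopologicalSpace H] (φ : H →ₜ* G) (hφ : ∀ h : H, θ (φ h) = 1) :
    (scalar (M := M) θ).restrict φ = trivial H A M := by
  ext h m
  simp [hφ h]

end Literature.NumberTheory.GaloisRepresentations.ContinuousRep

/-! ## §2b. The character instance on `ℚ_p/ℤ_p` -/

namespace Literature.NumberTheory.IwasawaTheory.QpModZp

variable (p : ℕ) [Fact p.Prime] {G : Type*} [Group G] [TopologicalSpace G]

/-- **`A_θ := ℚ_p/ℤ_p(θ)`** — the continuous representation of `G` on the Prüfer module `ℚ_p/ℤ_p`
(g10's `QpModZp p`, Mathlib's quotient topology, which is discrete) through a continuous character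
`θ : G →ₜ* ℤ_pˣ`: Greenberg's rank-one `D` ([Gr4] p. 342), KY's `(F/𝓞)(θ)` for `F = ℚ_p`. The
`A`, `ρ₀` of the cell's instance theorem with ALL its duality data supplied by
`PruferPontryaginDual` at `e := LinearEquiv.refl`. [cite: Greenberg2006, p. 342 L2–5]
[cite: KellerYin2024, §1.1 (arXiv:2402.12781v2 TeX L441–449)] -/
def characterRep (θ : G →ₜ* ℤ_[p]ˣ) : ContinuousRep G ℤ_[p] (QpModZp p) :=
  haveI := continuousSMul p
  ContinuousRep.scalar θ

variable {p}

/-- Unfolding: `characterRep θ g a = θ(g) • a`. [cite: Greenberg2006, p. 342 L2–5] -/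
@[simp] theorem characterRep_apply (θ : G →ₜ* ℤ_[p]ˣ) (g : G) (a : QpModZp p) :
    characterRep p θ g a = ((θ g : ℤ_[p]ˣ) : ℤ_[p]) • a :=
  rfl

/-- `hscalar` for `A_θ = ℚ_p/ℤ_p(θ)`: the binder of `…TwistDeformationFullAtSelmer` verbatim.
[cite: Greenberg2006, p. 342 L2–5] -/
theorem characterRep_hscalar (θ : G →ₜ* ℤ_[p]ˣ) (g : G) :
    ∃ t : ℤ_[p]ˣ, ∀ a : QpModZp p, characterRep p θ g a = (t : ℤ_[p]) • a :=
  ⟨θ g, fun _ ↦ rfl⟩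

/-- Restriction of `A_θ` along `φ` is `A_{θ ∘ φ}`. [cite: Greenberg2006, p. 342 L2–5 (the rank-one representation `ρ₀`, restriction to subgroups)] -/
theorem characterRep_restrict (θ : G →ₜ* ℤ_[p]ˣ) {H : Type*} [Group H] [TopologicalSpace H]
    (φ : H →ₜ* G) : (characterRep p θ).restrict φ = characterRep p (θ.comp φ) :=
  rfl

/-- Over a subgroup killed by `θ`, `A_θ` is `ℚ_p/ℤ_p` with the trivial action.
[cite: Greenberg2006, pp. 343–344] -/
theorem characterRep_restrict_eq_trivial (θ : G →ₜ* ℤ_[p]ˣ) {H : Type*} [Group H]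
    [TopologicalSpace H] (φ : H →ₜ* G) (hφ : ∀ h : H, θ (φ h) = 1) :
    (characterRep p θ).restrict φ = ContinuousRep.trivial H ℤ_[p] (QpModZp p) := by
  ext h a
  simp [hφ h]

end Literature.NumberTheory.IwasawaTheory.QpModZp


/-! ## §3. `𝒪_{ℚ_p(∅)} = ℤ_p` and `ℚ_p(∅) = ℚ_p` inside `ℚ̄_p` -/

namespace Literature.NumberTheory.EllipticCurves.KellerYin2024

open Literature.NumberTheory.IwasawaTheory

variable (p : ℕ) [Fact p.Prime]

/-- The tautological ring map `ℤ_p → 𝒪_{ℚ_p(∅)} = {x ∈ ℚ_p(∅) : |x| ≤ 1} ⊂ ℚ̄_p` (through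
`ℚ_p → ℚ̄_p`). KY §1.1: "`𝓞` the ring of integers of a finite extension `F/ℚ_p`"; here `F = ℚ_p`.
[cite: KellerYin2024, §1.1 (arXiv:2402.12781v2 TeX L441–449)] -/
def padicIntToCoeffIntegersEmpty : ℤ_[p] →+* padicCoeffIntegers (∅ : Set (PadicAlgCl p)) :=
  RingHom.codRestrict ((algebraMap ℚ_[p] (PadicAlgCl p)).comp PadicInt.Coe.ringHom)
    (padicCoeffIntegers (∅ : Set (PadicAlgCl p))) fun z ↦
      ⟨IntermediateField.algebraMap_mem _ (z : ℚ_[p]), by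
        change ‖algebraMap ℚ_[p] (PadicAlgCl p) (z : ℚ_[p])‖ ≤ 1
        rw [norm_algebraMap']
        exact z.2⟩

/-- Unfolding: the underlying element of `ℚ̄_p`. [cite: KellerYin2024, §1.1 (arXiv:2402.12781v2 TeX L441–449: `𝓞` the ring of integers of `F`, `θ : G_K → 𝓞^×`)] -/
@[simp] theorem coe_padicIntToCoeffIntegersEmpty (z : ℤ_[p]) :
    ((padicIntToCoeffIntegersEmpty p z : padicCoeffIntegers (∅ : Set (PadicAlgCl p))) : PadicAlgCl p) =
      algebraMap ℚ_[p] (PadicAlgCl p) (z : ℚ_[p]) :=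
  rfl

/-- Norms are preserved: `‖z‖ = ‖ι z‖`. [cite: KellerYin2024, §1.1 (arXiv:2402.12781v2 TeX L441–449: `𝓞` the ring of integers of `F`, `θ : G_K → 𝓞^×`)] -/
theorem norm_padicIntToCoeffIntegersEmpty (z : ℤ_[p]) :
    ‖((padicIntToCoeffIntegersEmpty p z : padicCoeffIntegers (∅ : Set (PadicAlgCl p))) : PadicAlgCl p)‖ =
      ‖z‖ := by
  rw [coe_padicIntToCoeffIntegersEmpty, norm_algebraMap']
  rfl

/-- Every integer of `ℚ_p(∅) = ℚ_p ⊆ ℚ̄_p` comes from `ℤ_p` (`IntermediateField.adjoin_empty`,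
`norm_algebraMap'`). (Same computation as the tree's
`exists_padicInt_eq_of_mem_padicCoeffIntegers_empty` in the Rubin file, reproved here to keep this
module's imports light.) [cite: KellerYin2024, §1.1 (arXiv:2402.12781v2 TeX L441–449: `𝓞` the ring of integers of `F`, `θ : G_K → 𝓞^×`)] -/
theorem padicIntToCoeffIntegersEmpty_surjective :
    Function.Surjective (padicIntToCoeffIntegersEmpty p) := by
  intro r
  obtain ⟨hr, hr1⟩ := r.2
  have hbot : (r : PadicAlgCl p) ∈ (⊥ : IntermediateField ℚ_[p] (PadicAlgCl p)) := by
    have : padicCoeffField (∅ : Set (PadicAlgCl p)) = ⊥ := IntermediateField.adjoin_empty _ _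
    rw [← this]; exact hr
  rw [IntermediateField.mem_bot] at hbot
  obtain ⟨q, hq⟩ := hbot
  have hq1 : ‖q‖ ≤ 1 := by
    have : ‖algebraMap ℚ_[p] (PadicAlgCl p) q‖ ≤ 1 := by rw [hq]; exact hr1
    rwa [norm_algebraMap'] at this
  exact ⟨⟨q, hq1⟩, Subtype.ext hq⟩

/-- … and the map is injective. [cite: KellerYin2024, §1.1 (arXiv:2402.12781v2 TeX L441–449: `𝓞` the ring of integers of `F`, `θ : G_K → 𝓞^×`)] -/
theorem padicIntToCoeffIntegersEmpty_injective :
    Function.Injective (padicIntToCoeffIntegersEmpty p) := by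
  intro a b h
  have h' := congrArg (fun x : padicCoeffIntegers (∅ : Set (PadicAlgCl p)) ↦ (x : PadicAlgCl p)) h
  simp only [coe_padicIntToCoeffIntegersEmpty] at h'
  exact Subtype.ext ((algebraMap ℚ_[p] (PadicAlgCl p)).injective h')

/-- **`ℤ_p ≅ 𝒪_{ℚ_p(∅)}`** as rings (KY's `𝓞` for `F = ℚ_p`; the `dim χ = 1` / `S = ∅` case of the
tree's coefficient rings). [cite: KellerYin2024, §1.1 (arXiv:2402.12781v2 TeX L441–449)] -/
def padicIntEquivCoeffIntegersEmpty : ℤ_[p] ≃+* padicCoeffIntegers (∅ : Set (PadicAlgCl p)) :=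
  RingEquiv.ofBijective (padicIntToCoeffIntegersEmpty p)
    ⟨padicIntToCoeffIntegersEmpty_injective p, padicIntToCoeffIntegersEmpty_surjective p⟩

/-- Unfolding the ring isomorphism on elements of `ℚ̄_p`. [cite: KellerYin2024, §1.1 (arXiv:2402.12781v2 TeX L441–449: `𝓞` the ring of integers of `F`, `θ : G_K → 𝓞^×`)] -/
@[simp] theorem coe_padicIntEquivCoeffIntegersEmpty (z : ℤ_[p]) :
    ((padicIntEquivCoeffIntegersEmpty p z : padicCoeffIntegers (∅ : Set (PadicAlgCl p))) : PadicAlgCl p) =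
      algebraMap ℚ_[p] (PadicAlgCl p) (z : ℚ_[p]) :=
  rfl

/-- The inverse isomorphism, characterised in `ℚ̄_p`: `ι (e⁻¹ c) = c`. [cite: KellerYin2024, §1.1 (arXiv:2402.12781v2 TeX L441–449: `𝓞` the ring of integers of `F`, `θ : G_K → 𝓞^×`)] -/
@[simp] theorem algebraMap_padicIntEquivCoeffIntegersEmpty_symm
    (c : padicCoeffIntegers (∅ : Set (PadicAlgCl p))) :
    algebraMap ℚ_[p] (PadicAlgCl p) (((padicIntEquivCoeffIntegersEmpty p).symm c : ℤ_[p]) : ℚ_[p]) =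
      (c : PadicAlgCl p) := by
  conv_rhs => rw [← (padicIntEquivCoeffIntegersEmpty p).apply_symm_apply c]
  rfl

/-- The isomorphism is an ISOMETRY `ℤ_p ≃ᵢ 𝒪_{ℚ_p(∅)}` (norms in `ℚ̄_p` extend those of `ℚ_p`), so
both it and its inverse are continuous. [cite: KellerYin2024, §1.1 (arXiv:2402.12781v2 TeX L441–449: `𝓞` the ring of integers of `F`, `θ : G_K → 𝓞^×`)] -/
def padicIntIsometryEquivCoeffIntegersEmpty : ℤ_[p] ≃ᵢ padicCoeffIntegers (∅ : Set (PadicAlgCl p)) :=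
  IsometryEquiv.mk (padicIntEquivCoeffIntegersEmpty p).toEquiv
    (Isometry.of_dist_eq fun a b ↦ by
      change dist ((padicIntEquivCoeffIntegersEmpty p a : padicCoeffIntegers _) : PadicAlgCl p)
          ((padicIntEquivCoeffIntegersEmpty p b : padicCoeffIntegers _) : PadicAlgCl p) = dist a b
      rw [dist_eq_norm, dist_eq_norm, coe_padicIntEquivCoeffIntegersEmpty,
        coe_padicIntEquivCoeffIntegersEmpty, ← map_sub, norm_algebraMap']
      rfl)

/-- `ℤ_p → 𝒪_{ℚ_p(∅)}` is continuous. [cite: KellerYin2024, §1.1 (arXiv:2402.12781v2 TeX L441–449: `𝓞` the ring of integers of `F`, `θ : G_K → 𝓞^×`)] -/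
theorem continuous_padicIntEquivCoeffIntegersEmpty :
    Continuous (padicIntEquivCoeffIntegersEmpty p) :=
  (padicIntIsometryEquivCoeffIntegersEmpty p).continuous

/-- `𝒪_{ℚ_p(∅)} → ℤ_p` is continuous. [cite: KellerYin2024, §1.1 (arXiv:2402.12781v2 TeX L441–449: `𝓞` the ring of integers of `F`, `θ : G_K → 𝓞^×`)] -/
theorem continuous_padicIntEquivCoeffIntegersEmpty_symm :
    Continuous (padicIntEquivCoeffIntegersEmpty p).symm :=
  (padicIntIsometryEquivCoeffIntegersEmpty p).symm.continuous

/-- **`ℚ_p(∅) ≅ ℚ_p`** as `ℚ_p`-algebras (`IntermediateField.adjoin_empty`, `botEquiv`).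
[cite: KellerYin2024, §1.1 (F a finite extension of ℚ_p; here F = ℚ_p)] -/
def coeffFieldEmptyAlgEquiv : padicCoeffField (∅ : Set (PadicAlgCl p)) ≃ₐ[ℚ_[p]] ℚ_[p] :=
  (IntermediateField.equivOfEq (IntermediateField.adjoin_empty ℚ_[p] (PadicAlgCl p))).trans
    (IntermediateField.botEquiv ℚ_[p] (PadicAlgCl p))

/-- The field isomorphism, characterised in `ℚ̄_p`: `ι (e x) = x`. [cite: KellerYin2024, §1.1 (arXiv:2402.12781v2 TeX L441–449: `𝓞` the ring of integers of `F`, `θ : G_K → 𝓞^×`)] -/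
@[simp] theorem algebraMap_coeffFieldEmptyAlgEquiv (x : padicCoeffField (∅ : Set (PadicAlgCl p))) :
    algebraMap ℚ_[p] (PadicAlgCl p) (coeffFieldEmptyAlgEquiv p x) = (x : PadicAlgCl p) := by
  set y : (⊥ : IntermediateField ℚ_[p] (PadicAlgCl p)) :=
    IntermediateField.equivOfEq (IntermediateField.adjoin_empty ℚ_[p] (PadicAlgCl p)) x with hy
  have hxy : (x : PadicAlgCl p) = (y : PadicAlgCl p) := by
    rw [hy, IntermediateField.equivOfEq_apply]
  have h1 : coeffFieldEmptyAlgEquiv p x = IntermediateField.botEquiv ℚ_[p] (PadicAlgCl p) y := rfl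
  have h2 : (algebraMap ℚ_[p] (⊥ : IntermediateField ℚ_[p] (PadicAlgCl p)))
      (IntermediateField.botEquiv ℚ_[p] (PadicAlgCl p) y) = y := by
    rw [← IntermediateField.botEquiv_symm, AlgEquiv.symm_apply_apply]
  rw [h1, hxy]
  conv_rhs => rw [← h2]
  rw [IntermediateField.coe_algebraMap_apply]

/-- The inverse, characterised in `ℚ̄_p`: `(e⁻¹ q) = ι q`. [cite: KellerYin2024, §1.1 (arXiv:2402.12781v2 TeX L441–449: `𝓞` the ring of integers of `F`, `θ : G_K → 𝓞^×`)] -/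
@[simp] theorem coe_coeffFieldEmptyAlgEquiv_symm (q : ℚ_[p]) :
    (((coeffFieldEmptyAlgEquiv p).symm q : padicCoeffField (∅ : Set (PadicAlgCl p))) : PadicAlgCl p) =
      algebraMap ℚ_[p] (PadicAlgCl p) q := by
  rw [← algebraMap_coeffFieldEmptyAlgEquiv p ((coeffFieldEmptyAlgEquiv p).symm q),
    AlgEquiv.apply_symm_apply]

/-- Compatibility of the two isomorphisms along `𝒪 → F`: `e_F (c) = e_𝒪⁻¹(c)` in `ℚ_p`. [cite: KellerYin2024, §1.1 (arXiv:2402.12781v2 TeX L441–449: `𝓞` the ring of integers of `F`, `θ : G_K → 𝓞^×`)] -/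
theorem coeffFieldEmptyAlgEquiv_algebraMap (c : padicCoeffIntegers (∅ : Set (PadicAlgCl p))) :
    coeffFieldEmptyAlgEquiv p (algebraMap (padicCoeffIntegers (∅ : Set (PadicAlgCl p)))
        (padicCoeffField (∅ : Set (PadicAlgCl p))) c) =
      (((padicIntEquivCoeffIntegersEmpty p).symm c : ℤ_[p]) : ℚ_[p]) := by
  apply (algebraMap ℚ_[p] (PadicAlgCl p)).injective
  rw [algebraMap_coeffFieldEmptyAlgEquiv, algebraMap_padicIntEquivCoeffIntegersEmpty_symm]
  rfl

end Literature.NumberTheory.EllipticCurves.KellerYin2024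


/-! ## §4. The unit character of `θ : Γ_K → GL₁(𝒪_{ℚ_p(∅)})` and `(F/𝓞)(θ) ≃ ℚ_p/ℤ_p(θ)` -/

namespace Literature.NumberTheory.EllipticCurves.KellerYin2024

open Literature.NumberTheory.IwasawaTheory
open _root_.Matrix

variable {K : Type} [Field K] {p : ℕ} [Fact p.Prime]
  (θ : FramedGaloisRep K (padicCoeffIntegers (∅ : Set (PadicAlgCl p))) 1)

/-- **The `ℤ_p`-valued character of `θ : Γ_K → GL₁(𝓞)`**, `𝓞 = 𝒪_{ℚ_p(∅)} ≅ ℤ_p`: `σ ↦ det θ(σ)`,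
read in `ℤ_pˣ` (continuous). KY §1.1: "a character `θ : G_K → 𝓞^×`".
[cite: KellerYin2024, §1.1 (arXiv:2402.12781v2 TeX L441–449)] -/
def unitChar : absoluteGaloisGroup K →ₜ* ℤ_[p]ˣ :=
  ContinuousMonoidHom.comp
    ⟨Units.map (padicIntEquivCoeffIntegersEmpty p).symm.toRingHom.toMonoidHom,
      Continuous.units_map _ (continuous_padicIntEquivCoeffIntegersEmpty_symm p)⟩
    (FramedRep.det θ)

/-- Unfolding the unit character in `𝓞`: `e (unitChar θ σ) = θ(σ)₀₀`. [cite: KellerYin2024, §1.1] -/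
theorem padicIntEquiv_unitChar (σ : absoluteGaloisGroup K) :
    padicIntEquivCoeffIntegersEmpty p ((unitChar θ σ : ℤ_[p]ˣ) : ℤ_[p]) =
      ((θ σ : GL (Fin 1) (padicCoeffIntegers (∅ : Set (PadicAlgCl p)))) :
        Matrix (Fin 1) (Fin 1) (padicCoeffIntegers (∅ : Set (PadicAlgCl p)))) 0 0 := by
  have h : ((unitChar θ σ : ℤ_[p]ˣ) : ℤ_[p]) = (padicIntEquivCoeffIntegersEmpty p).symm
      ((Matrix.GeneralLinearGroup.det (θ σ) : (padicCoeffIntegers (∅ : Set (PadicAlgCl p)))ˣ) :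
        padicCoeffIntegers (∅ : Set (PadicAlgCl p))) := rfl
  rw [h, RingEquiv.apply_symm_apply, Matrix.GeneralLinearGroup.val_det_apply, Matrix.det_fin_one]

/-- If `θ^n = 1` pointwise then `(unitChar θ)^n = 1` pointwise. [cite: KellerYin2024, §1.1 (arXiv:2402.12781v2 TeX L441–449: `𝓞` the ring of integers of `F`, `θ : G_K → 𝓞^×`)] -/
theorem unitChar_pow_eq_one {n : ℕ} (hθ : ∀ σ : absoluteGaloisGroup K, θ σ ^ n = 1)
    (σ : absoluteGaloisGroup K) : unitChar θ σ ^ n = 1 := by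
  change (Units.map (padicIntEquivCoeffIntegersEmpty p).symm.toRingHom.toMonoidHom)
      (Matrix.GeneralLinearGroup.det (θ σ)) ^ n = 1
  rw [← map_pow, ← map_pow, hθ σ, map_one, map_one]

/-- A continuous homomorphism into a Hausdorff group with FINITE image has OPEN kernel (the image
is discrete). Used: a character of finite order has open kernel, so `liftUnramified` /
`ramificationSubgroup_le_ker` of `RestrictedRamification` apply. [cite: SerreGaloisCohomology1997, Ch. I §1.1 (open subgroups of profinite groups), §2.1] -/
theorem continuousMonoidHom_isOpen_ker_of_finite_range
    {G H : Type*} [Group G] [TopologicalSpace G] [Group H] [TopologicalSpace H] [T1Space H]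
    (χ : G →ₜ* H) (hfin : (Set.range χ).Finite) :
    IsOpen ((χ.toMonoidHom.ker : Subgroup G) : Set G) := by
  have hT : IsClosed (Set.range χ \ {1}) := (hfin.subset Set.sdiff_subset).isClosed
  have hker : ((χ.toMonoidHom.ker : Subgroup G) : Set G) = χ ⁻¹' (Set.range χ \ {1})ᶜ := by
    ext g
    simp only [SetLike.mem_coe, MonoidHom.mem_ker, ContinuousMonoidHom.coe_toMonoidHom,
      Set.mem_preimage, Set.mem_compl_iff, Set.mem_sdiff, Set.mem_range_self, Set.mem_singleton_iff,
      true_and, not_not]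
    rfl
  rw [hker]
  exact hT.isOpen_compl.preimage (map_continuous χ)

/-- A character of finite order (`θ^n = 1`, `0 < n`) has open kernel. [cite: SerreGaloisCohomology1997, Ch. I §1.1 (open subgroups of profinite groups), §2.1] -/
theorem isOpen_ker_unitChar_of_pow_eq_one {n : ℕ} (hn : 0 < n)
    (hθ : ∀ σ : absoluteGaloisGroup K, θ σ ^ n = 1) :
    IsOpen (((unitChar θ).toMonoidHom.ker : Subgroup (absoluteGaloisGroup K)) :
      Set (absoluteGaloisGroup K)) := by
  refine continuousMonoidHom_isOpen_ker_of_finite_range (unitChar θ) ?_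
  have hsub : Set.range (unitChar θ) ⊆
      (Units.val : ℤ_[p]ˣ → ℤ_[p]) ⁻¹' ↑(Polynomial.nthRootsFinset n (1 : ℤ_[p])) := by
    rintro _ ⟨σ, rfl⟩
    simp only [Set.mem_preimage, Finset.mem_coe, Polynomial.mem_nthRootsFinset hn]
    rw [← Units.val_pow_eq_pow_val, unitChar_pow_eq_one θ hθ σ, Units.val_one]
  exact ((Finset.finite_toSet _).preimage Units.val_injective.injOn).subset hsub

/-- **A character of order prime to `p` has image of cardinality prime to `p`** — the hypothesis
shape of the LEO road's descent step (Serre I §2.4: index prime to `p`; planner RULING L67 (1)(d):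
"`Nat.Coprime (Nat.card (range θ)) p`"), discharged from `stub_noPseudoNull`'s `∀ σ, θ σ ^ n = 1`,
`0 < n`, `¬ p ∣ n` (Cauchy: an element of order `p` in the image would force `p ∣ n`).
[cite: SerreGaloisCohomology1997, Ch. I §2.4 (Corollaire to Prop. 9)] -/
theorem coprime_card_range_unitChar_of_pow_eq_one {n : ℕ} (hn : 0 < n) (hpn : ¬ p ∣ n)
    (hθ : ∀ σ : absoluteGaloisGroup K, θ σ ^ n = 1) :
    Nat.Coprime (Nat.card (unitChar θ).toMonoidHom.range) p := by
  have hfin : (Set.range (unitChar θ)).Finite := by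
    have hsub : Set.range (unitChar θ) ⊆
        (Units.val : ℤ_[p]ˣ → ℤ_[p]) ⁻¹' ↑(Polynomial.nthRootsFinset n (1 : ℤ_[p])) := by
      rintro _ ⟨σ, rfl⟩
      simp only [Set.mem_preimage, Finset.mem_coe, Polynomial.mem_nthRootsFinset hn]
      rw [← Units.val_pow_eq_pow_val, unitChar_pow_eq_one θ hθ σ, Units.val_one]
    exact ((Finset.finite_toSet _).preimage Units.val_injective.injOn).subset hsub
  haveI : Finite (unitChar θ).toMonoidHom.range := by
    have : (((unitChar θ).toMonoidHom.range : Subgroup ℤ_[p]ˣ) : Set ℤ_[p]ˣ).Finite := by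
      rw [MonoidHom.coe_range]; exact hfin
    exact this.to_subtype
  rw [Nat.coprime_comm, (Fact.out : p.Prime).coprime_iff_not_dvd]
  intro hdvd
  obtain ⟨x, hx⟩ := exists_prime_orderOf_dvd_card' p hdvd
  obtain ⟨σ, hσx⟩ := MonoidHom.mem_range.mp x.2
  have hpow : x ^ n = 1 := by
    apply Subtype.ext
    rw [SubgroupClass.coe_pow, ← hσx, OneMemClass.coe_one]
    exact unitChar_pow_eq_one θ hθ σ
  have h1 : orderOf x ∣ n := orderOf_dvd_of_pow_eq_one hpow
  rw [hx] at h1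
  exact hpn h1

/-! ### The identification `(F/𝓞)(θ) ≃ ℚ_p/ℤ_p` -/

/-- The coordinate map `F¹ → ℚ_p`, `x ↦ e_F(x₀)`, semilinear along `e_𝒪⁻¹ : 𝓞 → ℤ_p`. [cite: KellerYin2024, §1.1 (arXiv:2402.12781v2 TeX L441–449: `𝓞` the ring of integers of `F`, `θ : G_K → 𝓞^×`)] -/
def coordToPadic :
    (Fin 1 → padicCoeffField (∅ : Set (PadicAlgCl p))) →ₛₗ[(padicIntEquivCoeffIntegersEmpty p).symm.toRingHom]
      ℚ_[p] where
  toFun x := coeffFieldEmptyAlgEquiv p (x 0)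
  map_add' x y := by simp
  map_smul' c x := by
    change coeffFieldEmptyAlgEquiv p (c • x 0) =
      (padicIntEquivCoeffIntegersEmpty p).symm c • coeffFieldEmptyAlgEquiv p (x 0)
    rw [Algebra.smul_def, map_mul, coeffFieldEmptyAlgEquiv_algebraMap, Algebra.smul_def,
      PadicInt.algebraMap_apply]

/-- Unfolding `coordToPadic`. [cite: KellerYin2024, §1.1 (arXiv:2402.12781v2 TeX L441–449: `𝓞` the ring of integers of `F`, `θ : G_K → 𝓞^×`)] -/
@[simp] theorem coordToPadic_apply (x : Fin 1 → padicCoeffField (∅ : Set (PadicAlgCl p))) :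
    coordToPadic (p := p) x = coeffFieldEmptyAlgEquiv p (x 0) :=
  rfl

/-- The coordinate map `ℚ_p → F¹`, `q ↦ (e_F⁻¹ q)`, semilinear along `e_𝒪 : ℤ_p → 𝓞`. [cite: KellerYin2024, §1.1 (arXiv:2402.12781v2 TeX L441–449: `𝓞` the ring of integers of `F`, `θ : G_K → 𝓞^×`)] -/
def padicToCoord :
    ℚ_[p] →ₛₗ[(padicIntEquivCoeffIntegersEmpty p).toRingHom]
      (Fin 1 → padicCoeffField (∅ : Set (PadicAlgCl p))) where
  toFun q := fun _ ↦ (coeffFieldEmptyAlgEquiv p).symm q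
  map_add' x y := by ext; simp
  map_smul' z q := by
    funext i
    change (coeffFieldEmptyAlgEquiv p).symm (z • q) =
      padicIntEquivCoeffIntegersEmpty p z • (coeffFieldEmptyAlgEquiv p).symm q
    rw [Algebra.smul_def, PadicInt.algebraMap_apply, map_mul, Algebra.smul_def]
    congr 1

/-- Unfolding `padicToCoord`. [cite: KellerYin2024, §1.1 (arXiv:2402.12781v2 TeX L441–449: `𝓞` the ring of integers of `F`, `θ : G_K → 𝓞^×`)] -/
@[simp] theorem padicToCoord_apply (q : ℚ_[p]) (i : Fin 1) :
    padicToCoord (p := p) q i = (coeffFieldEmptyAlgEquiv p).symm q :=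
  rfl

/-- The lattice `𝓞¹ ⊂ F¹` maps into `ℤ_p ⊂ ℚ_p`. [cite: KellerYin2024, §1.1 (arXiv:2402.12781v2 TeX L441–449: `𝓞` the ring of integers of `F`, `θ : G_K → 𝓞^×`)] -/
theorem lattice_le_comap_coordToPadic :
    GreenbergSelmer.lattice 1 (padicCoeffIntegers (∅ : Set (PadicAlgCl p)))
        (padicCoeffField (∅ : Set (PadicAlgCl p))) ≤
      (1 : Submodule ℤ_[p] ℚ_[p]).comap (coordToPadic (p := p)) := by
  intro x hx
  obtain ⟨y, rfl⟩ := (GreenbergSelmer.mem_lattice_iff x).mp hx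
  rw [Submodule.mem_comap, coordToPadic_apply, coeffFieldEmptyAlgEquiv_algebraMap, Submodule.mem_one]
  exact ⟨_, PadicInt.algebraMap_apply _⟩

/-- `ℤ_p ⊂ ℚ_p` maps into the lattice `𝓞¹ ⊂ F¹`. [cite: KellerYin2024, §1.1 (arXiv:2402.12781v2 TeX L441–449: `𝓞` the ring of integers of `F`, `θ : G_K → 𝓞^×`)] -/
theorem one_le_comap_padicToCoord :
    (1 : Submodule ℤ_[p] ℚ_[p]) ≤
      (GreenbergSelmer.lattice 1 (padicCoeffIntegers (∅ : Set (PadicAlgCl p)))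
        (padicCoeffField (∅ : Set (PadicAlgCl p)))).comap (padicToCoord (p := p)) := by
  intro q hq
  obtain ⟨z, rfl⟩ := Submodule.mem_one.mp hq
  rw [Submodule.mem_comap, GreenbergSelmer.mem_lattice_iff]
  refine ⟨fun _ ↦ padicIntEquivCoeffIntegersEmpty p z, funext fun i ↦ ?_⟩
  rw [padicToCoord_apply]
  apply (coeffFieldEmptyAlgEquiv p).injective
  rw [AlgEquiv.apply_symm_apply, coeffFieldEmptyAlgEquiv_algebraMap, RingEquiv.symm_apply_apply,
    PadicInt.algebraMap_apply]

/-- `(F/𝓞)(θ) → ℚ_p/ℤ_p` on quotients (semilinear along `e_𝒪⁻¹`). [cite: KellerYin2024, §1.1 (arXiv:2402.12781v2 TeX L441–449: `𝓞` the ring of integers of `F`, `θ : G_K → 𝓞^×`)] -/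
def charModuleToPrufer :
    charModule (∅ : Set (PadicAlgCl p)) θ →ₛₗ[(padicIntEquivCoeffIntegersEmpty p).symm.toRingHom]
      QpModZp p :=
  Submodule.mapQ _ (1 : Submodule ℤ_[p] ℚ_[p]) (coordToPadic (p := p))
    (lattice_le_comap_coordToPadic (p := p))

/-- `ℚ_p/ℤ_p → (F/𝓞)(θ)` on quotients (semilinear along `e_𝒪`). [cite: KellerYin2024, §1.1 (arXiv:2402.12781v2 TeX L441–449: `𝓞` the ring of integers of `F`, `θ : G_K → 𝓞^×`)] -/
def pruferToCharModule :
    QpModZp p →ₛₗ[(padicIntEquivCoeffIntegersEmpty p).toRingHom]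
      charModule (∅ : Set (PadicAlgCl p)) θ :=
  Submodule.mapQ (1 : Submodule ℤ_[p] ℚ_[p]) _ (padicToCoord (p := p))
    (one_le_comap_padicToCoord (p := p))

/-- Unfolding on classes: `[x] ↦ [e_F(x₀)]`. [cite: KellerYin2024, §1.1 (arXiv:2402.12781v2 TeX L441–449: `𝓞` the ring of integers of `F`, `θ : G_K → 𝓞^×`)] -/
@[simp] theorem charModuleToPrufer_cofreeMk (x : Fin 1 → padicCoeffField (∅ : Set (PadicAlgCl p))) :
    charModuleToPrufer θ (GreenbergSelmer.cofreeMk _ θ x) = QpModZp.mk p (coeffFieldEmptyAlgEquiv p (x 0)) :=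
  Submodule.mapQ_apply _ _ _ x

/-- Unfolding on classes: `[q] ↦ [(e_F⁻¹ q)]`. [cite: KellerYin2024, §1.1 (arXiv:2402.12781v2 TeX L441–449: `𝓞` the ring of integers of `F`, `θ : G_K → 𝓞^×`)] -/
@[simp] theorem pruferToCharModule_mk (q : ℚ_[p]) :
    pruferToCharModule θ (QpModZp.mk p q) = GreenbergSelmer.cofreeMk _ θ (padicToCoord (p := p) q) :=
  Submodule.mapQ_apply _ _ _ q

/-- **`(F/𝓞)(θ) ≃ ℚ_p/ℤ_p`** additively (KY's `A = (F/𝓞)(θ)` for `F = ℚ_p`, Def. of §1.1, IS the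
Prüfer module of the cell's instance theorem): the additive equivalence underlying
`charModuleToPrufer`; `ℤ_p`/`𝓞`-semilinear (`charModuleEquiv_smul`) and `Γ_K`-EQUIVARIANT for
`θ` vs `unitChar θ` (`charModuleEquiv_galois_smul`). [cite: KellerYin2024, §1.1 (arXiv:2402.12781v2 TeX L441–449)]
[cite: Greenberg2006, p. 341 L6–10, p. 342 L2–5] -/
def charModuleEquiv : charModule (∅ : Set (PadicAlgCl p)) θ ≃+ QpModZp p where
  toFun := charModuleToPrufer θ
  invFun := pruferToCharModule θ
  left_inv a := by
    obtain ⟨x, rfl⟩ := GreenbergSelmer.cofreeMk_surjective _ θ a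
    rw [charModuleToPrufer_cofreeMk, pruferToCharModule_mk]
    congr 1
    funext i
    rw [padicToCoord_apply, AlgEquiv.symm_apply_apply, Fin.fin_one_eq_zero i]
  right_inv b := by
    obtain ⟨q, rfl⟩ := Submodule.Quotient.mk_surjective _ b
    change charModuleToPrufer θ (pruferToCharModule θ (QpModZp.mk p q)) = QpModZp.mk p q
    rw [pruferToCharModule_mk, charModuleToPrufer_cofreeMk, padicToCoord_apply,
      AlgEquiv.apply_symm_apply]
  map_add' a b := map_add _ a b

/-- Unfolding on classes: `e [x] = [e_F(x₀)]`. [cite: KellerYin2024, §1.1 (arXiv:2402.12781v2 TeX L441–449: `𝓞` the ring of integers of `F`, `θ : G_K → 𝓞^×`)] -/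
@[simp] theorem charModuleEquiv_cofreeMk (x : Fin 1 → padicCoeffField (∅ : Set (PadicAlgCl p))) :
    charModuleEquiv θ (GreenbergSelmer.cofreeMk _ θ x) = QpModZp.mk p (coeffFieldEmptyAlgEquiv p (x 0)) :=
  charModuleToPrufer_cofreeMk θ x

/-- **Semilinearity**: `e (c • a) = e_𝒪⁻¹(c) • e a` for `c ∈ 𝓞`. [cite: KellerYin2024, §1.1 (arXiv:2402.12781v2 TeX L441–449: `𝓞` the ring of integers of `F`, `θ : G_K → 𝓞^×`)] -/
theorem charModuleEquiv_smul (c : padicCoeffIntegers (∅ : Set (PadicAlgCl p)))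
    (a : charModule (∅ : Set (PadicAlgCl p)) θ) :
    charModuleEquiv θ (c • a) = (padicIntEquivCoeffIntegersEmpty p).symm c • charModuleEquiv θ a :=
  (charModuleToPrufer θ).map_smulₛₗ c a

/-- … equivalently `e (e_𝒪(z) • a) = z • e a` for `z ∈ ℤ_p`. [cite: KellerYin2024, §1.1 (arXiv:2402.12781v2 TeX L441–449: `𝓞` the ring of integers of `F`, `θ : G_K → 𝓞^×`)] -/
theorem charModuleEquiv_equiv_smul (z : ℤ_[p]) (a : charModule (∅ : Set (PadicAlgCl p)) θ) :
    charModuleEquiv θ (padicIntEquivCoeffIntegersEmpty p z • a) = z • charModuleEquiv θ a := by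
  rw [charModuleEquiv_smul, RingEquiv.symm_apply_apply]

/-- **`Γ_K`-equivariance**: `e (σ • a) = unitChar θ (σ) • e a` — the Galois action on `(F/𝓞)(θ)`
(through `θ`, `GreenbergSelmer.instDistribMulActionCofree`) is the scalar action of the unit character
on `ℚ_p/ℤ_p`. [cite: KellerYin2024, §1.1 (arXiv:2402.12781v2 TeX L441–449)] [cite: Greenberg2006, p. 342 L2–5] -/
theorem charModuleEquiv_galois_smul (σ : absoluteGaloisGroup K)
    (a : charModule (∅ : Set (PadicAlgCl p)) θ) :
    charModuleEquiv θ (σ • a) = ((unitChar θ σ : ℤ_[p]ˣ) : ℤ_[p]) • charModuleEquiv θ a := by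
  obtain ⟨x, rfl⟩ := GreenbergSelmer.cofreeMk_surjective _ θ a
  rw [GreenbergSelmer.smul_cofreeMk, charModuleEquiv_cofreeMk, charModuleEquiv_cofreeMk,
    QpModZp.smul_mk, GreenbergSelmer.fracRepresentation_apply_apply]
  congr 1
  have h0 : (((θ σ : GL (Fin 1) (padicCoeffIntegers (∅ : Set (PadicAlgCl p)))) :
      Matrix (Fin 1) (Fin 1) (padicCoeffIntegers (∅ : Set (PadicAlgCl p)))).map
        (algebraMap (padicCoeffIntegers (∅ : Set (PadicAlgCl p))) (padicCoeffField (∅ : Set (PadicAlgCl p))))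
        *ᵥ x) 0 =
      algebraMap _ (padicCoeffField (∅ : Set (PadicAlgCl p)))
        (((θ σ : GL (Fin 1) (padicCoeffIntegers (∅ : Set (PadicAlgCl p)))) :
          Matrix (Fin 1) (Fin 1) (padicCoeffIntegers (∅ : Set (PadicAlgCl p)))) 0 0) * x 0 := by
    simp [Matrix.mulVec, dotProduct]
  rw [h0, map_mul, coeffFieldEmptyAlgEquiv_algebraMap, ← padicIntEquiv_unitChar θ σ,
    RingEquiv.symm_apply_apply]

/-- `ℚ_p/ℤ_p(θ)` is `p`-primary in the `ℕ`-scalar currency `hA` of the instance theorem — the brick's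
`QpModZp.exists_pow_nsmul_eq_zero`, re-exported next to the identification for the consumer.
[cite: Greenberg2006, p. 341 L6–10] -/
theorem charModule_hA (a : QpModZp p) : ∃ k : ℕ, p ^ k • a = 0 :=
  QpModZp.exists_pow_nsmul_eq_zero a

end Literature.NumberTheory.EllipticCurves.KellerYin2024


/-! ## §5. Descent to `G_{K,S} = Gal(K_Σ/K)`: `ρ_θ` as a representation unramified outside `S` -/

namespace Literature.NumberTheory.GaloisRepresentations

variable {K : Type u} [Field K] (S : Set (HeightOneSpectrum (𝓞 K)))
  {H : Type*} [Group H] [TopologicalSpace H]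

/-- **Continuous factorisation through `G_{K,S}`** of a continuous homomorphism `χ : Γ_K →ₜ* H`
killing the ramification subgroup `N_S` (the continuous companion of `liftUnramified`, which is
stated for bare homomorphisms with open kernel): `G_{K,S} = Γ_K ⧸ N_S` carries the quotient
topology, so the lift is continuous. [cite: NeukirchSchmidtWingberg2008, VIII §3] -/
def liftUnramifiedCont (χ : absoluteGaloisGroup K →ₜ* H)
    (h : ramificationSubgroup K S ≤ χ.toMonoidHom.ker) : GaloisGroupUnramifiedOutside K S →ₜ* H where
  toMonoidHom := QuotientGroup.lift _ χ.toMonoidHom h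
  continuous_toFun := by
    change Continuous (QuotientGroup.lift _ χ.toMonoidHom h)
    refine (QuotientGroup.isOpenQuotientMap_mk.isQuotientMap.continuous_iff).mpr ?_
    exact map_continuous χ

/-- `liftUnramifiedCont χ ∘ (Γ_K ↠ G_{K,S}) = χ`. [cite: NeukirchSchmidtWingberg2008, VIII §3 (`G_S` as a quotient of `G_k`)] -/
@[simp] theorem liftUnramifiedCont_mk (χ : absoluteGaloisGroup K →ₜ* H)
    (h : ramificationSubgroup K S ≤ χ.toMonoidHom.ker) (σ : absoluteGaloisGroup K) :
    liftUnramifiedCont S χ h (toUnramifiedQuot K S σ) = χ σ :=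
  rfl

end Literature.NumberTheory.GaloisRepresentations

namespace Literature.NumberTheory.EllipticCurves.KellerYin2024

open Literature.NumberTheory.IwasawaTheory

variable {K : Type} [Field K] {p : ℕ} [Fact p.Prime] (S : Set (HeightOneSpectrum (𝓞 K)))
  (θ : FramedGaloisRep K (padicCoeffIntegers (∅ : Set (PadicAlgCl p))) 1)

/-- **`ρ_θ : G_{K,S} → Aut(ℚ_p/ℤ_p)`** — the `ρ₀` of the cell's instance theorem
(`…TwistDeformationFullAtSelmer.twistDeformation_fullAtSelmer_isAlmostDivisible`, `A := QpModZp p`)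
for KY's character `θ`, GIVEN that `θ` is unramified outside `S` in the form `N_S ≤ ker (unitChar θ)`
(from `ramificationSubgroup_le_ker` + `isOpen_ker_unitChar_of_pow_eq_one` for a character of finite
order trivial on the inertia groups outside `S`). [cite: KellerYin2024, §1.1 (arXiv:2402.12781v2 TeX L441–449)]
[cite: Greenberg2006, p. 341 L6–10, p. 342 L2–5] -/
def characterRepUnramified (h : ramificationSubgroup K S ≤ (unitChar θ).toMonoidHom.ker) :
    ContinuousRep (GaloisGroupUnramifiedOutside K S) ℤ_[p] (QpModZp p) :=
  QpModZp.characterRep p (liftUnramifiedCont S (unitChar θ) h)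

/-- Unfolding on classes of `σ ∈ Γ_K`: `ρ_θ(σ̄) b = unitChar θ (σ) • b`. [cite: KellerYin2024, §1.1] -/
@[simp] theorem characterRepUnramified_mk_apply (h : ramificationSubgroup K S ≤ (unitChar θ).toMonoidHom.ker)
    (σ : absoluteGaloisGroup K) (b : QpModZp p) :
    characterRepUnramified S θ h (toUnramifiedQuot K S σ) b = ((unitChar θ σ : ℤ_[p]ˣ) : ℤ_[p]) • b :=
  rfl

/-- `hscalar` for `ρ_θ` (binder of the instance theorem, verbatim shape). [cite: Greenberg2006, p. 342 L2–5] -/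
theorem characterRepUnramified_hscalar (h : ramificationSubgroup K S ≤ (unitChar θ).toMonoidHom.ker)
    (g : GaloisGroupUnramifiedOutside K S) :
    ∃ t : ℤ_[p]ˣ, ∀ a : QpModZp p, characterRepUnramified S θ h g a = (t : ℤ_[p]) • a :=
  QpModZp.characterRep_hscalar _ g

/-- **Equivariance along `Γ_K ↠ G_{K,S}`**: `e (σ • a) = ρ_θ(σ̄) (e a)` — the identification
`(F/𝓞)(θ) ≃ ℚ_p/ℤ_p` intertwines KY's `Γ_K`-module with the instance theorem's `(A, ρ₀)`.
[cite: KellerYin2024, §1.1 (arXiv:2402.12781v2 TeX L441–449)] [cite: Greenberg2006, p. 342 L2–5] -/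
theorem charModuleEquiv_galois_smul_unramified
    (h : ramificationSubgroup K S ≤ (unitChar θ).toMonoidHom.ker) (σ : absoluteGaloisGroup K)
    (a : charModule (∅ : Set (PadicAlgCl p)) θ) :
    charModuleEquiv θ (σ • a) =
      characterRepUnramified S θ h (toUnramifiedQuot K S σ) (charModuleEquiv θ a) :=
  charModuleEquiv_galois_smul θ σ a

/-- Restricting `ρ_θ` along any `φ : H →ₜ* G_{K,S}` whose image is killed by the character (e.g. the
inclusion of `Gal(K_Σ/K̃_∞K_θ)`) gives `ℚ_p/ℤ_p` with the TRIVIAL action — the coefficient module of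
the tree's weak-Leopoldt fact over `K_θ`. [cite: Greenberg2006, pp. 343–344] -/
theorem characterRepUnramified_restrict_eq_trivial
    (h : ramificationSubgroup K S ≤ (unitChar θ).toMonoidHom.ker) {H : Type*} [Group H]
    [TopologicalSpace H] (φ : H →ₜ* GaloisGroupUnramifiedOutside K S)
    (hφ : ∀ x : H, liftUnramifiedCont S (unitChar θ) h (φ x) = 1) :
    (characterRepUnramified S θ h).restrict φ = ContinuousRep.trivial H ℤ_[p] (QpModZp p) :=
  QpModZp.characterRep_restrict_eq_trivial _ φ hφ

end Literature.NumberTheory.EllipticCurves.KellerYin2024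

end
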